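import Literature.MathematicalPhysics.QuantumLattice.FinDimSpectrum
import Literature.MathematicalPhysics.QuantumLattice.FinDimSpectrumSectorGibbsLimit
import Literature.MathematicalPhysics.QuantumLattice.SectorEigenvalueContinuation

/-!
# Sketch — ZERO-AVERAGE (Reynolds / Jensen) deformation transfer, PROVED (hub-lb-sym-idea-3 g1)

Rider to the barrier note of LINE symidea1-L1 «ODD-DEF» (hub-lb-sym-idea-1; F0 DEAD both channels,
pub/hub-lb/STATUS l.890/l.892): the exact-side transfer `E_K(H+V) ≤ E_K(H)` needs neither an involution
`g` with `g V g⁻¹ = -V` nor concavity; it holds for every deformation `V` whose REYNOLDS AVERAGE over a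
finite family of unitary symmetries of `H` vanishes, `∑ i, (g i)ᴴ V (g i) = 0` — i.e. for every `V`
supported on the non-trivial isotypic components of any finite symmetry group of `H` (D₄ irreps
A₂ / B₁ / B₂ / E, spin flip, period-`p` superlattice patterns via the translations of a `p`-cell torus, …;
compact groups such as spin-SU(2) rank-1/rank-2 tensors follow by Haar averaging, not typed here).
Proof (variational): for a unit vector `ψ ∈ K`, the rotated trial states `g i ψ ∈ K` have
`⟨g i ψ, (H+V) g i ψ⟩ = ⟨ψ, H ψ⟩ + ⟨ψ, (g i)ᴴ V (g i) ψ⟩`, whose average over `i` is `⟨ψ, H ψ⟩`; take the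
infimum over `ψ`. No `H`-invariance of `K`, no `K ≠ ⊥` (junk-safe: both sides are `sInf ∅` when `K = ⊥`).
`OddDeformationTransfer` of sym-idea-1 (`Cruxes/LowerEdge_ge_m4o5/SketchOddDeformation.lean`, restated
VERBATIM below because crux workfiles are not importable) is the case `ι = Bool`, `g false = 1`,
`g true = g`, and is therefore PROVED here (`oddDeformationTransfer_holds`) — it was the one unproved
hypothesis of `lowerBound_transfer` (sym-idea-1) and `lowerBound_transfer_gc` (sym-idea-4).
So the CLASS the F0 numbers speak to is «zero-average deformations of a G-invariant relaxation», not only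
«odd» ones. HONEST FRAMING: elementary finite-dimensional linear algebra; no bound, no number; the line it
serves is DEAD by value; nothing here predicts superconductivity; no summit or crux statement is proved.
-/

namespace Summit.Ventures.CertifiedManyBodySolver.Cruxes.LowerEdge_ge_m4o5.ZeroAverageDeformation

open Matrix Literature.MathematicalPhysics.QuantumLattice
  Literature.MathematicalPhysics.QuantumLattice.EigenvalueContinuation

/-- ZERO-AVERAGE DEFORMATION TRANSFER. For Hermitian `H`, `V` on a finite-dimensional space, a finite
nonempty family of unitaries `g i` commuting with `H` and preserving the sector `K`, if the Reynolds
average of `V` vanishes (`∑ i, (g i)ᴴ * V * g i = 0`) then `E_K(H + V) ≤ E_K(H)`. -/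
def ZeroAverageDeformationTransfer : Prop :=
  ∀ (n : Type) [Fintype n] [DecidableEq n] (ι : Type) [Fintype ι] [Nonempty ι]
    (H V : Matrix n n ℂ) (g : ι → Matrix n n ℂ) (K : Submodule ℂ (n → ℂ)),
    H.IsHermitian → V.IsHermitian → (∀ i, (g i)ᴴ * g i = 1) → (∀ i, g i * H = H * g i) →
    (∑ i, (g i)ᴴ * V * g i = 0) → (∀ i, ∀ ψ ∈ K, g i *ᵥ ψ ∈ K) →
    (H + V).minEnergyOn K ≤ H.minEnergyOn K

/-- VERBATIM COPY of sym-idea-1's `…Cruxes.LowerEdge_ge_m4o5.OddDeformation.OddDeformationTransfer`. -/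
def OddDeformationTransfer : Prop :=
  ∀ (n : Type) [Fintype n] [DecidableEq n] (H V g : Matrix n n ℂ) (K : Submodule ℂ (n → ℂ)),
    H.IsHermitian → V.IsHermitian → gᴴ * g = 1 → g * H = H * g → g * V = -(V * g) →
    (∀ ψ ∈ K, g *ᵥ ψ ∈ K) →
    ∀ ε : ℝ, (H + (ε : ℂ) • V).minEnergyOn K ≤ H.minEnergyOn K

/-- Rayleigh data transport under a matrix: `⟨M ψ, X (M ψ)⟩ = ⟨ψ, (Mᴴ X M) ψ⟩`. [folklore] -/
theorem star_mulVec_dotProduct_mulVec {n : Type} [Fintype n] (M X : Matrix n n ℂ) (ψ : n → ℂ) :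
    star (M *ᵥ ψ) ⬝ᵥ (X *ᵥ (M *ᵥ ψ)) = star ψ ⬝ᵥ ((Mᴴ * X * M) *ᵥ ψ) := by
  rw [star_mulVec, mulVec_mulVec, dotProduct_mulVec, vecMul_vecMul, ← dotProduct_mulVec,
    ← Matrix.mul_assoc]

/-- The Rayleigh set defining `minEnergyOn _ ⊥` is empty (no unit vector in `⊥`). [folklore] -/
theorem rayleighSet_bot_eq_empty {n : Type} [Fintype n] (X : Matrix n n ℂ) :
    {E : ℝ | ∃ ψ ∈ (⊥ : Submodule ℂ (n → ℂ)), star ψ ⬝ᵥ ψ = 1 ∧ E = (star ψ ⬝ᵥ X *ᵥ ψ).re} = ∅ := by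
  ext E
  simp only [Set.mem_setOf_eq, Set.mem_empty_iff_false, iff_false]
  rintro ⟨ψ, hψ, h1, -⟩
  rw [Submodule.mem_bot] at hψ
  subst hψ
  simp at h1

theorem zeroAverageDeformationTransfer_holds : ZeroAverageDeformationTransfer := by
  intro n _ _ ι _ _ H V g K hH hV hU hC hZ hgK
  classical
  have hHV : (H + V).IsHermitian := hH.add hV
  by_cases hK : K = ⊥
  · subst hK
    show sInf _ ≤ sInf _
    rw [rayleighSet_bot_eq_empty, rayleighSet_bot_eq_empty]
  -- `K ≠ ⊥`: bound `E_K(H+V)` by the `H`-Rayleigh quotient of EVERY unit `ψ ∈ K`, then take the infimum.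
  obtain ⟨w, hwK, hw0⟩ := Submodule.exists_mem_ne_zero_of_ne_bot hK
  obtain ⟨c, -, -, hc1⟩ := exists_normalize hw0
  show (H + V).minEnergyOn K ≤ sInf {E : ℝ | ∃ ψ ∈ K, star ψ ⬝ᵥ ψ = 1 ∧ E = (star ψ ⬝ᵥ H *ᵥ ψ).re}
  refine le_csInf ⟨_, (c : ℂ) • w, K.smul_mem _ hwK, hc1, rfl⟩ ?_
  rintro E ⟨ψ, hψK, hψ1, rfl⟩
  -- each rotated trial state is a unit vector of `K`
  have hunit : ∀ i, star (g i *ᵥ ψ) ⬝ᵥ (g i *ᵥ ψ) = 1 := by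
    intro i
    have := star_mulVec_dotProduct_mulVec (g i) 1 ψ
    rw [one_mulVec, Matrix.mul_one, hU i, one_mulVec] at this
    rw [this, hψ1]
  -- Rayleigh quotient of the rotated state for `H + V`
  have hray : ∀ i, (star (g i *ᵥ ψ) ⬝ᵥ ((H + V) *ᵥ (g i *ᵥ ψ))).re
      = (star ψ ⬝ᵥ H *ᵥ ψ).re + (star ψ ⬝ᵥ (((g i)ᴴ * V * g i) *ᵥ ψ)).re := by
    intro i
    rw [star_mulVec_dotProduct_mulVec, Matrix.mul_add, Matrix.add_mul, add_mulVec,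
      dotProduct_add, Complex.add_re]
    congr 1
    have hgHg : (g i)ᴴ * H * g i = H := by
      rw [Matrix.mul_assoc, ← hC i, ← Matrix.mul_assoc, hU i, Matrix.one_mul]
    rw [hgHg]
  -- each Rayleigh quotient bounds `E_K(H+V)` from above
  have hle : ∀ i, (H + V).minEnergyOn K
      ≤ (star ψ ⬝ᵥ H *ᵥ ψ).re + (star ψ ⬝ᵥ (((g i)ᴴ * V * g i) *ᵥ ψ)).re := by
    intro i
    rw [← hray i]
    exact minEnergyOn_le_rayleigh_of_mem hHV K (hgK i ψ hψK) (hunit i)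
  -- sum over the family: the `V`-terms add up to `⟨ψ, 0 ψ⟩ = 0`
  have hsum : ∑ i, (star ψ ⬝ᵥ (((g i)ᴴ * V * g i) *ᵥ ψ)).re = 0 := by
    let φ : Matrix n n ℂ →+ ℝ :=
      { toFun := fun M => (star ψ ⬝ᵥ (M *ᵥ ψ)).re
        map_zero' := by simp
        map_add' := fun A B => by simp [add_mulVec, dotProduct_add] }
    have hφ : ∀ M, φ M = (star ψ ⬝ᵥ (M *ᵥ ψ)).re := fun M => rfl
    have := map_sum φ (fun i => (g i)ᴴ * V * g i) Finset.univ
    simp only [hφ] at this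
    rw [← this, hZ, zero_mulVec, dotProduct_zero, Complex.zero_re]
  have hcard : (0 : ℝ) < Fintype.card ι := by exact_mod_cast Fintype.card_pos
  have htot : (Fintype.card ι : ℝ) * (H + V).minEnergyOn K
      ≤ (Fintype.card ι : ℝ) * (star ψ ⬝ᵥ H *ᵥ ψ).re := by
    have := Finset.sum_le_sum fun i (_ : i ∈ Finset.univ) => hle i
    rw [Finset.sum_const, Finset.card_univ, nsmul_eq_mul, Finset.sum_add_distrib, Finset.sum_const,
      Finset.card_univ, nsmul_eq_mul, hsum, add_zero] at this
    exact this
  exact le_of_mul_le_mul_left htot hcard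

/-- sym-idea-1's involutive («odd») transfer is the two-element case `g false = 1, g true = g`. -/
theorem oddDeformationTransfer_holds : OddDeformationTransfer := by
  intro n _ _ H V g K hH hV hg hgH hgV hK ε
  have hVε : ((ε : ℂ) • V).IsHermitian := by
    rw [IsHermitian, conjTranspose_smul, hV.eq, Complex.star_def, Complex.conj_ofReal]
  refine zeroAverageDeformationTransfer_holds n Bool H ((ε : ℂ) • V)
    (fun b => cond b g 1) K hH hVε ?_ ?_ ?_ ?_
  · rintro (_ | _)
    · simp
    · simpa using hg
  · rintro (_ | _)
    · simp
    · simpa using hgH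
  · -- Reynolds average: `1ᴴ (εV) 1 + gᴴ (εV) g = ε (V + gᴴ V g) = 0` since `gᴴ V g = -V`.
    have hgVg : gᴴ * V * g = -V := by
      rw [Matrix.mul_assoc, ← neg_neg (V * g), ← hgV, Matrix.mul_neg, ← Matrix.mul_assoc, hg,
        Matrix.one_mul]
    simp only [Fintype.sum_bool, cond_true, cond_false, conjTranspose_one, Matrix.one_mul,
      Matrix.mul_one, Matrix.mul_smul, Matrix.smul_mul, hgVg, smul_neg, neg_add_cancel]
  · rintro (_ | _) ψ hψ
    · simpa using hψ
    · simpa using hK ψ hψ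

end Summit.Ventures.CertifiedManyBodySolver.Cruxes.LowerEdge_ge_m4o5.ZeroAverageDeformation
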